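import Mathlib
import HarnessLib
import Summits.ValiantsHypothesis.ValiantsHypothesis.Theorems.LacunarySymmetroidMatrixDescartesProductPlusOneCrossingSign
import Summits.ValiantsHypothesis.ValiantsHypothesis.Theorems.LacunarySymmetroidMatrixDescartesProductPlusOnePosCoeff

/-!
# LINE (A) `product_plus_one` — RUNG 0 of `WronskianBudgetK3` (val-idea-25 g3 ask W0, 02:16Z): a SAME-SIGN company has NO positive zero of `W(∏ f_j)`

Crux item stmt-ValiantsHypothesis-18050, floor `OneChangeFloorK3`, successor cut EB2-W / def `WronskianBudgetK3` (LINE (A) rev 24): by ✓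
`card_posRoots_eulerNumerator_le_wronskian_add_of_oneChange` the floor is a budget on the positive zeros of ONE polynomial, the log-Wronskian
`W(P) = P·θ²P − (θP)²` of `P = ∏_j fewnomial d (a j)`.  RUNG 0 (every `K`, every support `d`, every `m`): if every row is ONE-SIGNED
(`a_{jl}·a_{jl'} ≥ 0` for all letters) then `W(P)` has NO positive zero — indeed ALL ITS COEFFICIENTS ARE NON-NEGATIVE:
`W(P) = Σ_j W(f_j)·∏_{i≠j} f_i²` (✓ `theta_wronskian_prod`) with `W(f_j) = Σ_{l,l'} C((d_l − d_{l'})²/2·a_{jl}a_{jl'}) X^{d_l+d_{l'}}` (✓ `logWronskian_fewnomial`)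
and `f_i² = Σ_{l,l'} C(a_{il}a_{il'}) X^{d_l+d_{l'}}`, so Descartes (✓ `countP_pos_roots_eq_zero_of_coeff_nonneg`) applies; the degenerate case `W(P) = 0` is
covered since `roots 0 = ∅`.

* `coeff_fewnomial_mul_self_nonneg`, `coeff_logWronskian_fewnomial_nonneg`, `coeff_mul_nonneg_of_coeff_nonneg`, `coeff_wronskian_prod_nonneg` — bookkeeping;
* ★ `card_posRoots_wronskian_prod_eq_zero_of_sameSign` — the rung (the `m_rooted = 0` case of EB2-W with constant 0).

HONEST FRAMING: Descartes bookkeeping; the FIRST rung of `WronskianBudgetK3`, not the budget; NOT `OneChangeFloorK3`, not `stub_classRowK3`, not `stub_polyLaw`,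
not `MatrixDescartes`, not Conjecture B; `VP ≠ VNP` is NOT proved.  No definitions, no named facts; Mathlib + ✓ `…CrossingSign` + ✓ `…PosCoeff` only.
-/

set_option linter.dupNamespace false

namespace Summit.ValiantsHypothesis.ValiantsHypothesis.Theorems.LacunarySymmetroidMatrixDescartes

namespace ProductPlusOne

open Polynomial Finset
open scoped BigOperators

/-- A one-signed fewnomial has a square with non-negative coefficients: `f² = Σ_{l,l'} C(a_l a_{l'}) X^{d_l + d_{l'}}`. [folklore] -/
theorem coeff_fewnomial_mul_self_nonneg {K : ℕ} (d : Fin K → ℕ) (b : Fin K → ℝ) (hb : ∀ l l', 0 ≤ b l * b l') (n : ℕ) :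
    0 ≤ ((∑ l, C (b l) * X ^ (d l) : ℝ[X]) * (∑ l, C (b l) * X ^ (d l) : ℝ[X])).coeff n := by
  have hsq : (∑ l, C (b l) * X ^ (d l) : ℝ[X]) * (∑ l, C (b l) * X ^ (d l) : ℝ[X])
      = ∑ l, ∑ l', C (b l * b l') * X ^ (d l + d l') := by
    rw [Finset.sum_mul_sum]
    refine Finset.sum_congr rfl fun l _ => Finset.sum_congr rfl fun l' _ => ?_
    rw [map_mul, pow_add]; ring
  rw [hsq, finsetSum_coeff]
  refine Finset.sum_nonneg fun l _ => ?_
  rw [finsetSum_coeff]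
  refine Finset.sum_nonneg fun l' _ => ?_
  rw [coeff_C_mul_X_pow]
  split_ifs
  · exact hb l l'
  · exact le_rfl

/-- A one-signed fewnomial has a log-Wronskian with non-negative coefficients (✓ `logWronskian_fewnomial`). [folklore] -/
theorem coeff_logWronskian_fewnomial_nonneg {K : ℕ} (d : Fin K → ℕ) (b : Fin K → ℝ) (hb : ∀ l l', 0 ≤ b l * b l') (n : ℕ) :
    0 ≤ ((∑ l, C (b l) * X ^ (d l) : ℝ[X]) * (X * derivative (X * derivative (∑ l, C (b l) * X ^ (d l) : ℝ[X])))
        - (X * derivative (∑ l, C (b l) * X ^ (d l) : ℝ[X])) ^ 2).coeff n := by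
  rw [logWronskian_fewnomial, finsetSum_coeff]
  refine Finset.sum_nonneg fun l _ => ?_
  rw [finsetSum_coeff]
  refine Finset.sum_nonneg fun l' _ => ?_
  rw [coeff_C_mul_X_pow]
  split_ifs
  · exact mul_nonneg (div_nonneg (sq_nonneg _) (by norm_num)) (hb l l')
  · exact le_rfl

/-- Product of two polynomials with non-negative coefficients has non-negative coefficients. [folklore] -/
theorem coeff_mul_nonneg_of_coeff_nonneg (p q : ℝ[X]) (hp : ∀ n, 0 ≤ p.coeff n) (hq : ∀ n, 0 ≤ q.coeff n) (n : ℕ) :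
    0 ≤ (p * q).coeff n := by
  rw [coeff_mul]
  exact Finset.sum_nonneg fun x _ => mul_nonneg (hp _) (hq _)

/-- **The log-Wronskian of a same-sign company has non-negative coefficients** (every `K`, `d`, `m`). [this file's lemma] -/
theorem coeff_wronskian_prod_nonneg {m K : ℕ} (d : Fin K → ℕ) (a : Fin m → Fin K → ℝ) (hsame : ∀ j l l', 0 ≤ a j l * a j l') (n : ℕ) :
    0 ≤ ((∏ j, ∑ l, C (a j l) * X ^ (d l) : ℝ[X]) * (X * derivative (X * derivative (∏ j, ∑ l, C (a j l) * X ^ (d l) : ℝ[X])))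
        - (X * derivative (∏ j, ∑ l, C (a j l) * X ^ (d l) : ℝ[X])) ^ 2).coeff n := by
  classical
  rw [theta_wronskian_prod (fun j => (∑ l, C (a j l) * X ^ (d l) : ℝ[X])), finsetSum_coeff]
  refine Finset.sum_nonneg fun j _ => ?_
  refine coeff_mul_nonneg_of_coeff_nonneg _ _ (coeff_logWronskian_fewnomial_nonneg d (a j) (hsame j)) ?_ n
  refine coeff_prod_nonneg _ _ fun i _ k => ?_
  rw [sq]
  exact coeff_fewnomial_mul_self_nonneg d (a i) (hsame i) k

/-- ★ **RUNG 0 of `WronskianBudgetK3` (val-idea-25 g3, W0): a SAME-SIGN company (`a_{jl}·a_{jl'} ≥ 0` for every row and all letters; every `K`, every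
support, every `m`) has NO positive zero of the log-Wronskian `W(∏_j f_j)`** — its coefficients are all non-negative (Descartes), and the degenerate
`W = 0` has `roots = ∅`. [this file's theorem] -/
theorem card_posRoots_wronskian_prod_eq_zero_of_sameSign {m K : ℕ} (d : Fin K → ℕ) (a : Fin m → Fin K → ℝ)
    (hsame : ∀ j l l', 0 ≤ a j l * a j l') :
    (((∏ j, ∑ l, C (a j l) * X ^ (d l) : ℝ[X]) * (X * derivative (X * derivative (∏ j, ∑ l, C (a j l) * X ^ (d l) : ℝ[X])))
        - (X * derivative (∏ j, ∑ l, C (a j l) * X ^ (d l) : ℝ[X])) ^ 2).roots.toFinset.filter (fun t => 0 < t)).card = 0 := by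
  have h0 := countP_pos_roots_eq_zero_of_coeff_nonneg _ (coeff_wronskian_prod_nonneg d a hsame)
  have hle := StubVLawTwo.card_filter_pos_le_countP
    (((∏ j, ∑ l, C (a j l) * X ^ (d l) : ℝ[X]) * (X * derivative (X * derivative (∏ j, ∑ l, C (a j l) * X ^ (d l) : ℝ[X])))
        - (X * derivative (∏ j, ∑ l, C (a j l) * X ^ (d l) : ℝ[X])) ^ 2))
  omega

end ProductPlusOne

end Summit.ValiantsHypothesis.ValiantsHypothesis.Theorems.LacunarySymmetroidMatrixDescartes
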